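import Summits.CriticalPhenomena.PercolationContinuityZ3.Theorems.PercNearOneGluingNoHeavyPcintSignedConfigCore
import HarnessLib

/-!
# CriticalPhenomena/PercolationContinuityZ3 — Theorems/PercNearOneGluingNoHeavyPcintSignedConfigPeel.lean: PEELING THE NEXT GAP of an arch configuration — the gap recursion for `E(S)`

Lane prim-pcint, STRUCTURE rule «numerics ⇒ structure ⇒ conjecture» (prim-pcint-2 GEN 22); sequel of …PcintSignedConfigCore.  An arch configuration
whose first `i` gaps are empty (`EPfx i`) and which has a point of rank `i+1` splits into its next gap `G = ngap c i` — a configuration of the class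
`F = G(false, [], none)` (no closed interval of weight zero) on `↥G` — and an arch configuration on `↥Gᶜ` whose first `i+1` gaps are empty
(`peel_mem`); conversely gluing such a pair along the block of ranks `(i, i+ℓ]` gives back an arch configuration with next gap that block
(`unpeel_mem`).  Counting:  `epCount i S N = Σ_{ℓ < N−i−1} Σ_{t ≤ |S|} gCount false [] none (S.take t) ℓ · epCount (i+1) (S.drop t) (N−ℓ)`
for `N ≥ i+2` (`epCount_rec`), and the all-core base `epCount i S (i+1) = [S = []]·#goodSet (Fin (i+1))` (`epCount_base`).

HONEST FRAMING: elementary finite combinatorics.  No `sorry`; standard axioms.  Written by prim-pcint-2 gen 22 (prover-prim-pcint-2-g22-0), 2026-08-27.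
-/

namespace Summit.CriticalPhenomena.PercolationContinuityZ3.Theorems.Pcint.ChordDiag

variable {α : Type*} [LinearOrder α] [Fintype α]

/-! ### The class `F` -/

/-- The class `G(false, [], none)` is the class `F`: well-formed, sign word, no closed interval of weight zero. [folklore] -/
theorem isGCfg_F_iff {T : List Bool} {c : Cfg α} : IsGCfg false [] none T c ↔ IsCfg c ∧ sw c = T ∧ FullSAW c := by
  unfold IsGCfg CondA CondB CondC
  simp

/-! ### Counting points of small rank -/

/-- There are `i+1` points of rank `≤ i` (when `i+1 ≤ #α`). [folklore] -/
theorem card_filter_rank_le {i : ℕ} (h : i + 1 ≤ Fintype.card α) : (Finset.univ.filter fun y : α => rank y ≤ i).card = i + 1 := by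
  classical
  rw [← Finset.card_range (i + 1)]
  refine Finset.card_bij (fun y _ => rank y) ?_ ?_ ?_
  · intro y hy
    rw [Finset.mem_filter] at hy
    rw [Finset.mem_range]; omega
  · intro y₁ _ y₂ _ hy
    exact rank_injective hy
  · intro j hj
    rw [Finset.mem_range] at hj
    obtain ⟨y, hy⟩ := exists_rank_eq (α := α) (i := j) (by omega)
    exact ⟨y, Finset.mem_filter.2 ⟨Finset.mem_univ _, by omega⟩, hy⟩

/-- A set containing every point of rank `≤ i` and a point of rank `> i` has at least `i+2` points. [folklore] -/
theorem card_ge_of_ranks {i : ℕ} (h : i + 1 ≤ Fintype.card α) {S : Finset α} (hS : ∀ y, rank y ≤ i → y ∈ S) {k : α} (hk : k ∈ S)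
    (hik : i < rank k) : i + 2 ≤ S.card := by
  classical
  have hsub : insert k (Finset.univ.filter fun y : α => rank y ≤ i) ⊆ S := by
    intro y hy
    rw [Finset.mem_insert] at hy
    rcases hy with rfl | hy
    · exact hk
    · exact hS y (Finset.mem_filter.1 hy).2
  have := Finset.card_le_card hsub
  rw [Finset.card_insert_of_notMem (by simp; omega), card_filter_rank_le h] at this
  omega

/-! ### Peeling the next gap -/

section Peel

variable {c : Cfg α} {i : ℕ} {S : List Bool}

/-- In the rest `↥Gᶜ` of an arch configuration, a closed set convex in the rest that meets the core is everything. [folklore] -/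
theorem rest_eq_univ_of_meets_core (hc : IsCfg c) (hI : Indec c) {G : Finset α} (hG : Closed c.1 G) (hGc : ∀ x ∈ G, x ∉ core c)
    {J' : Finset ↥(Gᶜ)} (hcv : Convex J') (hcl : Closed (resC c Gᶜ).1 J') (hx : ∃ x ∈ up J', x ∈ core c) : J' = Finset.univ := by
  classical
  have hGc' : Closed c.1 Gᶜ := hc.closed_compl hG
  set B := (up J').filter fun x => x ∈ core c
  have hB : B ⊆ core c := fun x hx => (Finset.mem_filter.1 hx).2
  have hBne : B.Nonempty := by obtain ⟨x, hx, hxc⟩ := hx; exact ⟨x, Finset.mem_filter.2 ⟨hx, hxc⟩⟩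
  have hBcv : ∀ ⦃x⦄, x ∈ B → ∀ ⦃y⦄, y ∈ B → ∀ ⦃t⦄, t ∈ core c → x ≤ t → t ≤ y → t ∈ B := by
    intro x hx y hy t ht hxt hty
    obtain ⟨hxJ, -⟩ := Finset.mem_filter.1 hx
    obtain ⟨hyJ, -⟩ := Finset.mem_filter.1 hy
    obtain ⟨hxG, hxJ'⟩ := mem_up.1 hxJ
    obtain ⟨hyG, hyJ'⟩ := mem_up.1 hyJ
    have htG : t ∈ Gᶜ := Finset.mem_compl.2 fun h => hGc t h ht
    refine Finset.mem_filter.2 ⟨mem_up.2 ⟨htG, hcv hxJ' hyJ' ?_ ?_⟩, ht⟩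
    · exact hxt
    · exact hty
  have hBcl : Closed c.1 B := by
    intro t ht
    obtain ⟨htJ, htc⟩ := Finset.mem_filter.1 ht
    exact Finset.mem_filter.2 ⟨(closed_resC_iff hGc' J').1 hcl htJ, closed_core hc htc⟩
  have hBK : B = core c := core_block hB hBne hBcv hBcl
  -- the core lies in `up J'`; by convexity in the rest, `J'` is everything
  have hu : (Finset.univ : Finset α).Nonempty := by obtain ⟨x, -, -⟩ := hx; exact ⟨x, Finset.mem_univ x⟩
  have hmin : Finset.univ.min' hu ∈ up J' := (Finset.mem_filter.1 (hBK ▸ min_mem_core hI hu : _ ∈ B)).1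
  have hmax : Finset.univ.max' hu ∈ up J' := (Finset.mem_filter.1 (hBK ▸ max_mem_core hc hI hu : _ ∈ B)).1
  refine Finset.eq_univ_of_forall fun z => ?_
  have := hcv ((coe_mem_up _).1 (show ((⟨_, (mem_up.1 hmin).1⟩ : ↥(Gᶜ)) : α) ∈ up J' from hmin))
    ((coe_mem_up _).1 (show ((⟨_, (mem_up.1 hmax).1⟩ : ↥(Gᶜ)) : α) ∈ up J' from hmax))
    (show (⟨_, (mem_up.1 hmin).1⟩ : ↥(Gᶜ)) ≤ z from Finset.min'_le _ _ (Finset.mem_univ _))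
    (show z ≤ ⟨_, (mem_up.1 hmax).1⟩ from Finset.le_max' _ _ (Finset.mem_univ _))
  exact this

/-- **Peeling**: the next gap of an arch configuration with `EPfx i` and a point of rank `i+1` is a configuration of the class `F`, the rest is an
arch configuration with `EPfx (i+1)` on at least `i+2` points, and the sign word splits accordingly. [folklore] -/
theorem peel_mem {G : Finset α} (hc : IsECfg S c) (hE : EPfx i c) (hN : i + 2 ≤ Fintype.card α) (hGdef : ngap c i = G) :
    IsGCfg false [] none (S.take (sw (resC c G)).length) (resC c G) ∧
      (IsECfg (S.drop (sw (resC c G)).length) (resC c Gᶜ) ∧ EPfx (i + 1) (resC c Gᶜ)) ∧ i + 2 ≤ Fintype.card ↥(Gᶜ) := by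
  classical
  obtain ⟨hc0, hsw, hI, hP⟩ := hc
  obtain ⟨k, hk, hik, hmin⟩ := exists_next_core hc0 hI hN
  have memG : ∀ {x}, x ∈ G ↔ i < rank x ∧ x < k := fun {x} => by rw [← hGdef]; exact mem_ngap_iff_lt hk hik hmin
  have hGcl : Closed c.1 G := hGdef ▸ closed_ngap hE
  have hGc' : Closed c.1 Gᶜ := hc0.closed_compl hGcl
  have hGcv : Convex G := hGdef ▸ convex_ngap c i
  have hkG : k ∉ G := fun h => lt_irrefl k (memG.1 h).2
  have hGK : ∀ x ∈ G, x ∉ core c := fun x hx => not_mem_core_of_mem_ngap (hGdef ▸ hx : x ∈ ngap c i)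
  -- points below `k` outside `G` have rank `≤ i`, hence are core points
  have hlow : ∀ y, y ∉ G → y < k → rank y ≤ i := fun y hyG hyk => not_lt.1 fun h => hyG (memG.2 ⟨h, hyk⟩)
  -- the sign word splits: letters in `G` precede letters outside `G`
  have hlt : ∀ a, c.1 a = a → a ∈ G → ∀ b, c.1 b = b → b ∉ G → a < b := by
    intro a _ haG b hb hbG
    have hbk : k ≤ b := by
      by_contra h
      exact not_letter_of_mem_core hI (hE b (hlow b hbG (not_le.1 h))) hb
    exact lt_of_lt_of_le (memG.1 haG).2 hbk
  have hsplit := sw_eq_append' hc0 hGcl hlt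
  rw [hsw] at hsplit
  set t := (sw (resC c G)).length
  have htake : sw (resC c G) = S.take t := by rw [hsplit, List.take_left]
  have hdrop : sw (resC c Gᶜ) = S.drop t := by rw [hsplit, List.drop_left]
  refine ⟨isGCfg_F_iff.2 ⟨hc0.resC hGcl, htake, fun J' hne hcv hclJ => ?_⟩, ⟨⟨hc0.resC hGc', hdrop, ⟨?_, fun J' hne hini hclJ => ?_⟩,
    fun J' hne hnu hcv hclJ => ?_⟩, fun x hx => ?_⟩, ?_⟩
  · -- the gap has no closed interval of weight zero
    rw [wt_resC hGcl]
    refine hP _ ((up_nonempty_iff J').2 hne) (fun h => hkG (up_subset J' (h ▸ Finset.mem_univ k))) ((convex_up_iff hGcv J').2 hcv)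
      ((closed_resC_iff hGcl J').1 hclJ)
  · -- the rest has a chord (at `k`)
    refine ⟨⟨k, Finset.mem_compl.2 hkG⟩, fun h => not_letter_of_mem_core hI hk ?_⟩
    exact (resC_letter_iff hGc' _).1 h
  · -- the rest is indecomposable
    by_cases hkJ : (⟨k, Finset.mem_compl.2 hkG⟩ : ↥(Gᶜ)) ∈ J'
    · -- `up J' ∪ G` is a closed initial segment of `c`
      have hJi : Init (up J' ∪ G) := by
        intro x hx y hyx
        rw [Finset.mem_union] at hx ⊢
        by_cases hyG : y ∈ G
        · exact Or.inr hyG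
        left
        rcases hx with hx | hx
        · obtain ⟨hxG, hxJ⟩ := mem_up.1 hx
          exact mem_up.2 ⟨Finset.mem_compl.2 hyG, hini hxJ (show (⟨y, _⟩ : ↥(Gᶜ)) ≤ ⟨x, hxG⟩ from hyx)⟩
        · have hyk : y ≤ k := hyx.trans (memG.1 hx).2.le
          exact mem_up.2 ⟨Finset.mem_compl.2 hyG, hini hkJ (show (⟨y, _⟩ : ↥(Gᶜ)) ≤ ⟨k, _⟩ from hyk)⟩
      have hJcl : Closed c.1 (up J' ∪ G) := by
        intro x hx
        rw [Finset.mem_union] at hx ⊢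
        rcases hx with hx | hx
        · exact Or.inl ((closed_resC_iff hGc' J').1 hclJ hx)
        · exact Or.inr (hGcl hx)
      have hJu := hI.2 _ (((up_nonempty_iff J').2 hne).mono Finset.subset_union_left) hJi hJcl
      refine Finset.eq_univ_of_forall fun z => (coe_mem_up z).1 ?_
      have hz : (z : α) ∈ up J' ∪ G := hJu ▸ Finset.mem_univ _
      rw [Finset.mem_union] at hz
      exact hz.resolve_right fun h => Finset.mem_compl.1 z.2 h
    · -- otherwise `up J'` itself is a closed initial segment of `c` missing `k`
      exfalso
      have hbelow : ∀ x ∈ J', (x : α) < k := fun x hx => by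
        by_contra h
        exact hkJ (hini hx (show (⟨k, _⟩ : ↥(Gᶜ)) ≤ x from not_lt.1 h))
      have hJi : Init (up J') := by
        intro x hx y hyx
        obtain ⟨hxG, hxJ⟩ := mem_up.1 hx
        have hyk : y < k := lt_of_le_of_lt hyx (hbelow _ hxJ)
        have hyr : rank y ≤ i := (rank_le_rank hyx).trans (hlow x (Finset.mem_compl.1 hxG) (hbelow _ hxJ))
        have hyG : y ∉ G := fun h => absurd hyr (not_le.2 (memG.1 h).1)
        exact mem_up.2 ⟨Finset.mem_compl.2 hyG, hini hxJ (show (⟨y, _⟩ : ↥(Gᶜ)) ≤ ⟨x, hxG⟩ from hyx)⟩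
      have hJu := hI.2 _ ((up_nonempty_iff J').2 hne) hJi ((closed_resC_iff hGc' J').1 hclJ)
      have : k ∈ up J' := hJu ▸ Finset.mem_univ k
      exact lt_irrefl k (hbelow _ ((coe_mem_up ⟨k, Finset.mem_compl.2 hkG⟩).1 this))
  · -- the rest has no proper closed interval of weight zero
    rw [wt_resC hGc']
    by_cases hx : ∃ x ∈ up J', x ∈ core c
    · exact absurd (rest_eq_univ_of_meets_core hc0 hI hGcl hGK hcv hclJ hx) hnu
    · push Not at hx
      -- `up J'` lies above `k` and is convex in `α`
      have habove : ∀ x ∈ up J', k < x := fun x hxJ => by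
        obtain ⟨hxG, -⟩ := mem_up.1 hxJ
        have hxc := hx x hxJ
        rcases lt_trichotomy x k with h | h | h
        · exact absurd (hE x (hlow x (Finset.mem_compl.1 hxG) h)) hxc
        · exact absurd (h ▸ hk) hxc
        · exact h
      have hJcv : Convex (up J') := by
        intro x hxJ y hyJ s hxs hsy
        have hsG : s ∉ G := fun h => lt_irrefl s (((memG.1 h).2.trans (habove x hxJ)).trans_le hxs)
        obtain ⟨hxG, hxJ'⟩ := mem_up.1 hxJ
        obtain ⟨hyG, hyJ'⟩ := mem_up.1 hyJ
        exact mem_up.2 ⟨Finset.mem_compl.2 hsG, hcv hxJ' hyJ' (show (⟨x, hxG⟩ : ↥(Gᶜ)) ≤ ⟨s, _⟩ from hxs)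
          (show (⟨s, _⟩ : ↥(Gᶜ)) ≤ ⟨y, hyG⟩ from hsy)⟩
      refine hP _ ((up_nonempty_iff J').2 hne) (fun h => hnu ?_) hJcv ((closed_resC_iff hGc' J').1 hclJ)
      exact (up_eq_iff_eq_univ J').1 (Finset.Subset.antisymm (up_subset J') (h ▸ Finset.subset_univ _))
  · -- the first `i+1` gaps of the rest are empty
    -- `x ≤ k`: otherwise the `i+2` points of rank `≤ i` and `k` lie below `x` in the rest
    have hxk : (x : α) ≤ k := by
      by_contra h
      have hlt' : i + 1 < rank x := by
        rw [rank_coe]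
        have h2 := card_ge_of_ranks (α := α) (i := i) (by omega) (S := (Gᶜ).filter (· < (x : α)))
          (fun y hy => Finset.mem_filter.2 ⟨Finset.mem_compl.2 fun hyG => absurd hy (not_le.2 (memG.1 hyG).1),
            lt_of_le_of_lt (le_iff_rank_le.2 (hy.trans hik.le)) (not_le.1 h)⟩)
          (Finset.mem_filter.2 ⟨Finset.mem_compl.2 hkG, not_le.1 h⟩) hik
        omega
      omega
    have hxc : (x : α) ∈ core c := by
      rcases hxk.lt_or_eq with h | h
      · exact hE _ (hlow _ (Finset.mem_compl.1 x.2) h)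
      · rw [h]; exact hk
    -- a core point of `c` outside `G` is a core point of the rest
    refine mem_core.2 fun J' hxJ hcv hclJ => rest_eq_univ_of_meets_core hc0 hI hGcl hGK hcv hclJ ⟨x, (coe_mem_up x).2 hxJ, hxc⟩
  · -- the rest has at least `i+2` points
    rw [Fintype.card_coe]
    exact card_ge_of_ranks (by omega) (fun y hy => Finset.mem_compl.2 fun hyG => absurd hy (not_le.2 (memG.1 hyG).1))
      (Finset.mem_compl.2 hkG) hik

/-! ### Gluing a gap in front of an arch configuration -/

/-- **Un-peeling**: a configuration of the class `F` on the block `G` of ranks `(i, i+ℓ]` and an arch configuration with `EPfx (i+1)` on `Gᶜ`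
glue to an arch configuration with `EPfx i` whose next gap is `G`. [folklore] -/
theorem unpeel_mem {ℓ : ℕ} (hN : i + ℓ + 2 ≤ Fintype.card α) {T S' : List Bool} {G : Finset α}
    (hG : ∀ x, x ∈ G ↔ i < rank x ∧ rank x < i + 1 + ℓ) {gc : Cfg ↥G} {rest : Cfg ↥(Gᶜ)}
    (hgc : IsGCfg false [] none T gc) (hrest : IsECfg S' rest) (hE : EPfx (i + 1) rest) :
    IsECfg (T ++ S') (glueC G rest gc) ∧ EPfx i (glueC G rest gc) ∧ ngap (glueC G rest gc) i = G := by
  classical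
  obtain ⟨hg0, hgsw, hgF⟩ := isGCfg_F_iff.1 hgc
  obtain ⟨hr0, hrsw, hrI, hrP⟩ := hrest
  obtain ⟨k, hk⟩ := exists_rank_eq (α := α) (i := i + 1 + ℓ) (by omega)
  have hu : (Finset.univ : Finset α).Nonempty := ⟨k, Finset.mem_univ k⟩
  set m := Finset.univ.min' hu with hmdef
  have hmle : ∀ x : α, m ≤ x := fun x => Finset.min'_le _ _ (Finset.mem_univ x)
  have hm0 : rank m = 0 := by
    obtain ⟨x0, hx0⟩ := exists_rank_eq (α := α) (i := 0) (by omega)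
    have := rank_le_rank (hmle x0)
    omega
  have hkG : k ∉ G := fun h => by have := (hG k).1 h; omega
  have hmG : m ∉ G := fun h => by have := (hG m).1 h; omega
  have hGcv : Convex G := fun x hx y hy t hxt hty =>
    (hG t).2 ⟨lt_of_lt_of_le ((hG x).1 hx).1 (rank_le_rank hxt), lt_of_le_of_lt (rank_le_rank hty) ((hG y).1 hy).2⟩
  have hGk : ∀ g ∈ G, g < k := fun g hg => lt_of_not_ge fun h => by
    have := rank_le_rank h; have := (hG g).1 hg; omega
  set c := glueC G rest gc with hcdef
  have hcl : Closed c.1 G := closed_glueC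
  have hc0 : IsCfg c := hr0.glueC hg0
  have hGc' : Closed c.1 Gᶜ := hc0.closed_compl hcl
  have hri : resC c G = gc := resC_glueC_right
  have hrr : resC c Gᶜ = rest := resC_glueC_left
  -- the points outside `G` below or at `k` are core points of the rest
  have hlowcore : ∀ x (hx : x ∈ Gᶜ), x ≤ k → (⟨x, hx⟩ : ↥(Gᶜ)) ∈ core rest := by
    intro x hx hxk
    refine hE _ ?_
    rw [rank_coe, ← card_filter_rank_le (α := α) (i := i) (by omega)]
    refine Finset.card_le_card fun y hy => ?_
    rw [Finset.mem_filter] at hy ⊢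
    refine ⟨Finset.mem_univ _, not_lt.1 fun hiy => (Finset.mem_compl.1 hy.1) ((hG y).2 ⟨hiy, ?_⟩)⟩
    have := rank_lt_rank (lt_of_lt_of_le hy.2 hxk); omega
  -- traces on `Gᶜ` of closed sets are closed for the rest
  have hclJ' : ∀ J : Finset α, Closed c.1 J → Closed rest.1 (J.subtype (· ∈ Gᶜ)) := fun J hJ => by
    rw [← hrr, closed_resC_iff hGc', up_subtype]
    intro x hx
    rw [Finset.mem_filter] at hx ⊢
    exact ⟨hJ hx.1, hGc' hx.2⟩
  have hcvJ' : ∀ J : Finset α, Convex J → Convex (J.subtype (· ∈ Gᶜ)) := fun J hJ x hx y hy t hxt hty =>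
    Finset.mem_subtype.2 (hJ (Finset.mem_subtype.1 hx) (Finset.mem_subtype.1 hy) hxt hty)
  -- a closed set convex in the rest containing a core point of the rest is everything; then `Gᶜ ⊆ J`
  have hfull : ∀ J : Finset α, Convex J → Closed c.1 J → ∀ p (hp : p ∈ Gᶜ), p ∈ J → p ≤ k → J = Finset.univ := by
    intro J hcv hclJ p hp hpJ hpk
    have hJ' := mem_core.1 (hlowcore p hp hpk) (J.subtype (· ∈ Gᶜ)) (Finset.mem_subtype.2 hpJ) (hcvJ' J hcv) (hclJ' J hclJ)
    have hsub : ∀ x, x ∈ Gᶜ → x ∈ J := fun x hx => Finset.mem_subtype.1 (hJ' ▸ Finset.mem_univ (⟨x, hx⟩ : ↥(Gᶜ)))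
    refine Finset.eq_univ_of_forall fun x => ?_
    by_cases hxG : x ∈ G
    · exact hcv (hsub m (Finset.mem_compl.2 hmG)) (hsub k (Finset.mem_compl.2 hkG)) (hmle x) (hGk x hxG).le
    · exact hsub x (Finset.mem_compl.2 hxG)
  -- dichotomy: a closed interval meeting `G` and `Gᶜ` is everything
  have hdich : ∀ J : Finset α, Convex J → Closed c.1 J → ∀ g ∈ J, g ∈ G → ∀ x ∈ J, x ∉ G → J = Finset.univ := by
    intro J hcv hclJ g hgJ hgG x hxJ hxG
    rcases lt_or_gt_of_ne (show x ≠ g from fun h => hxG (h ▸ hgG)) with hxg | hgx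
    · -- `x` below `g`: rank `x ≤ i`, so `x ≤ k`
      have hxk : x ≤ k := (hxg.trans (hGk g hgG)).le
      exact hfull J hcv hclJ x (Finset.mem_compl.2 hxG) hxJ hxk
    · -- `x` above `g`: then `k ≤ x` and `k ∈ J`
      have hkx : k ≤ x := by
        rw [le_iff_rank_le, hk]
        have h1 := rank_lt_rank hgx
        have h2 := (hG g).1 hgG
        by_contra h3
        exact hxG ((hG x).2 ⟨by omega, by omega⟩)
      have hkJ : k ∈ J := hcv hgJ hxJ (hGk g hgG).le hkx
      exact hfull J hcv hclJ k (Finset.mem_compl.2 hkG) hkJ le_rfl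
  -- the points of `G` are not core points
  have hGK : ∀ g ∈ G, g ∉ core c := fun g hg =>
    not_mem_core_of_mem hGcv hcl (fun h => hkG (h ▸ Finset.mem_univ k)) hg
  -- core points of the rest are core points
  have hcore : ∀ x (hx : x ∈ Gᶜ), (⟨x, hx⟩ : ↥(Gᶜ)) ∈ core rest → x ∈ core c := by
    intro x hx hxc
    refine mem_core.2 fun J hxJ hcv hclJ => ?_
    by_cases hg : ∃ g ∈ J, g ∈ G
    · obtain ⟨g, hgJ, hgG⟩ := hg
      exact hdich J hcv hclJ g hgJ hgG x hxJ (Finset.mem_compl.1 hx)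
    · push Not at hg
      have hJ' := mem_core.1 hxc (J.subtype (· ∈ Gᶜ)) (Finset.mem_subtype.2 hxJ) (hcvJ' J hcv) (hclJ' J hclJ)
      have hsub : ∀ y, y ∈ Gᶜ → y ∈ J := fun y hy => Finset.mem_subtype.1 (hJ' ▸ Finset.mem_univ (⟨y, hy⟩ : ↥(Gᶜ)))
      refine Finset.eq_univ_of_forall fun y => ?_
      by_cases hyG : y ∈ G
      · exact hcv (hsub m (Finset.mem_compl.2 hmG)) (hsub k (Finset.mem_compl.2 hkG)) (hmle y) (hGk y hyG).le
      · exact hsub y (Finset.mem_compl.2 hyG)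
  have hkc : k ∈ core c := hcore k (Finset.mem_compl.2 hkG) (hlowcore k _ le_rfl)
  -- letters in `G` precede letters outside `G`
  have hlt : ∀ a, c.1 a = a → a ∈ G → ∀ b, c.1 b = b → b ∉ G → a < b := by
    intro a _ haG b hb hbG
    refine lt_of_lt_of_le (hGk a haG) (le_of_not_gt fun hbk => ?_)
    have hbc := hlowcore b (Finset.mem_compl.2 hbG) hbk.le
    refine not_letter_of_mem_core hrI hbc ?_
    rw [← hrr, resC_letter_iff hGc']
    exact hb
  refine ⟨⟨hc0, ?_, ⟨⟨k, fun h => not_letter_of_mem_core hrI (hlowcore k (Finset.mem_compl.2 hkG) le_rfl) ?_⟩,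
    fun J hne hini hclJ => ?_⟩, fun J hne hnu hcv hclJ => ?_⟩, fun x hx => ?_, ?_⟩
  · rw [sw_eq_append' hc0 hcl hlt, hri, hrr, hgsw, hrsw]
  · rw [← hrr, resC_letter_iff hGc']; exact h
  · -- indecomposable
    have hmJ : m ∈ J := min_mem_of_init hne hini hu
    exact hfull J hini.convex hclJ m (Finset.mem_compl.2 hmG) hmJ (hmle k)
  · -- no proper closed interval of weight zero
    by_cases hg : ∃ g ∈ J, g ∈ G
    · obtain ⟨g, hgJ, hgG⟩ := hg
      by_cases hx : ∃ x ∈ J, x ∉ G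
      · obtain ⟨x, hxJ, hxG⟩ := hx
        exact absurd (hdich J hcv hclJ g hgJ hgG x hxJ hxG) hnu
      · push Not at hx
        have hJG : J ⊆ G := fun y hy => hx y hy
        set J'' := J.subtype (· ∈ G)
        have hupJ : up J'' = J := up_subtype_of_subset hJG
        rw [wt_eq_of_subset_part hcl hJG, hri]
        refine hgF J'' ⟨⟨g, hgG⟩, Finset.mem_subtype.2 hgJ⟩ ?_ ?_
        · rw [← convex_up_iff hGcv J'', hupJ]; exact hcv
        · rw [← hri, closed_resC_iff hcl J'', hupJ]; exact hclJ
    · push Not at hg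
      have hJG : J ⊆ Gᶜ := fun y hy => Finset.mem_compl.2 (hg y hy)
      obtain ⟨a, haJ⟩ := hne
      set J' := J.subtype (· ∈ Gᶜ)
      have hnu' : J' ≠ Finset.univ := by
        intro h
        apply hnu
        have hsub : ∀ y, y ∈ Gᶜ → y ∈ J := fun y hy => Finset.mem_subtype.1 (h ▸ Finset.mem_univ (⟨y, hy⟩ : ↥(Gᶜ)))
        refine Finset.eq_univ_of_forall fun y => ?_
        by_cases hyG : y ∈ G
        · exact hcv (hsub m (Finset.mem_compl.2 hmG)) (hsub k (Finset.mem_compl.2 hkG)) (hmle y) (hGk y hyG).le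
        · exact hsub y (Finset.mem_compl.2 hyG)
      rw [wt_eq_of_subset_part hGc' hJG, hrr]
      exact hrP J' ⟨⟨a, hJG haJ⟩, Finset.mem_subtype.2 haJ⟩ hnu' (hcvJ' J hcv) (hclJ' J hclJ)
  · -- `EPfx i`
    have hxG : x ∉ G := fun h => absurd hx (not_le.2 ((hG x).1 h).1)
    have hxk : x ≤ k := by rw [le_iff_rank_le, hk]; omega
    exact hcore x (Finset.mem_compl.2 hxG) (hlowcore x _ hxk)
  · -- the next gap is `G`
    ext x
    constructor
    · intro hx
      obtain ⟨hxr, hxy⟩ := mem_ngap.1 hx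
      by_contra hxG
      have hkx : k ≤ x := by
        rw [le_iff_rank_le, hk]
        by_contra h
        exact hxG ((hG x).2 ⟨hxr, by omega⟩)
      exact hxy k hkx (by omega) hkc
    · intro hxG
      refine mem_ngap.2 ⟨((hG x).1 hxG).1, fun y hyx hyr hyc => hGK y ((hG y).2 ⟨hyr, ?_⟩) hyc⟩
      exact lt_of_le_of_lt (rank_le_rank hyx) ((hG x).1 hxG).2

end Peel

end Summit.CriticalPhenomena.PercolationContinuityZ3.Theorems.Pcint.ChordDiag
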